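import Summits.NavierStokesRegularity.NavierStokesRegularity.Theorems.ArgmaxNearDoorsDefs
import Summits.NavierStokesRegularity.NavierStokesRegularity.Theorems.ArgmaxDoorsNearEngineWeighted
import Literature.Analysis.FluidPDE.ClassicalSolutionGlue
import HarnessLib

/-!
# ArgmaxNearDoorsEngine — S36 §A «ArgmaxNearDoors»: plates E♭ «NearEngine» and E♭w «NearEngineWeighted» BY NAME

Summits-side proof file (theorems only). Texts of record: nsreg-p1 g30 `r34/Sketch36A.lean` sha16 3ebc53b38700dd90
= tree P0-36A `Theorems/ArgmaxNearDoorsDefs.lean` (p651846). The two plates are the LEAD's landed closed-slab theorems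
`ArgmaxDoors.norm_curl_le_barrier_exp_of_argmax_rate_le` (p647868) and `…_weighted` (p650001) TIME-TRANSLATED to a
slab `[t₁,t₂] ⊂ [0,T)` of the open frame (`u ↦ u(· + t₁)` on `[0, t₂ − t₁]`), with the enstrophy spelled
`(∫‖ω(s)‖²)^{1/2}` (`toReal_eLpNorm_two_eq_sqrt`, `Real.sqrt_eq_rpow`) and the exponent moved back by
`intervalIntegral.integral_comp_add_right`.

* `nearEngine_holds : NearEngine`, `nearEngineWeighted_holds : NearEngineWeighted`.

HONEST FRAME / WHAT THIS IS NOT: engine plates of two regularity CRITERIA about hypothetical blow-up; item 0056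
`NoTypeII` and NS regularity are NOT proved; no Literature fact is taken as a hypothesis;
`--supports stmt-NavierStokesRegularity-0056 --as helper` (S-door lane, LEAD ns-s30-p1 g3).
-/

noncomputable section

set_option linter.dupNamespace false

open MeasureTheory Set Function Filter Metric Real InnerProductSpace
open _root_.Topology
open scoped ENNReal NNReal RealInnerProductSpace ContDiff Laplacian
open Literature.Analysis Literature.Analysis.FluidPDE
open Literature.Analysis.FluidPDE.VorticityDirectionDynamics

namespace Summit.NavierStokesRegularity.NavierStokesRegularity.Theorems.ArgmaxDoors

-- nested operator types (second derivatives)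
set_option maxSynthPendingDepth 3

set_option maxHeartbeats 800000 in
-- time translation bookkeeping in one declaration
/-- **Plate E♭w «NearEngineWeighted» PROVED BY NAME.** [folklore] -/
theorem nearEngineWeighted_holds : NearEngineWeighted := by
  intro ν T u p hν hsol hreg t₁ t₂ a ε c k ht₁ h₁₂ ht₂ ha hε hc hkc hk0 hrate hM s hs x
  rcases eq_or_lt_of_le h₁₂ with heq | hlt
  · -- degenerate slab
    have hst : s = t₁ := le_antisymm (heq ▸ hs.2) hs.1
    subst hst
    rw [intervalIntegral.integral_same, Real.exp_zero, mul_one]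
    exact hM x
  -- the translated closed slab `[0, L]`
  set L : ℝ := t₂ - t₁ with hLdef
  have hL : 0 < L := by rw [hLdef]; linarith
  set Trel : ℝ := T - t₁ with hTrel
  have hLT : L < Trel := by rw [hLdef, hTrel]; linarith
  set v : ℝ → (EuclideanSpace ℝ (Fin 3)) → (EuclideanSpace ℝ (Fin 3)) := fun r => u (r + t₁) with hv
  set q : ℝ → (EuclideanSpace ℝ (Fin 3)) → ℝ := fun r => p (r + t₁) with hq
  have hmem : ∀ r ∈ Icc (0 : ℝ) L, r + t₁ ∈ Icc t₁ t₂ := fun r hr =>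
    ⟨by linarith [hr.1], by rw [hLdef] at hr; linarith [hr.2]⟩
  have hS : IsClassicalNSSolutionOn (Icc 0 L) ν 0 v q :=
    (hsol.translate_Ico_zero ht₁).mono (fun r hr => ⟨hr.1, by rw [hLdef] at hr; linarith [hr.2]⟩)
      (uniqueDiffOn_Icc hL)
  have hB : HasBoundedSobolevNormsOn (Icc 0 L) v := by
    intro n
    obtain ⟨C', hC'⟩ := hreg t₂ ht₂ n
    exact ⟨C', fun r hr => hC' (r + t₁) ⟨by linarith [hr.1], by rw [hLdef] at hr; linarith [hr.2]⟩⟩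
  -- the enstrophy spelling on the slab
  obtain ⟨B₁, B₂, -, -, hpk⟩ := IntenseSetDoors.slice_package hS hB
  have hψ : ∀ r ∈ Icc 0 L, (eLpNorm (curl (v r)) 2 volume).toReal =
      (∫ y, ‖curl (u (r + t₁)) y‖ ^ 2) ^ (1 / (2 : ℝ)) := by
    intro r hr
    obtain ⟨hv3, -, -, i1, -, -, -⟩ := hpk r hr
    have hI : Integrable fun y => ‖curl (v r) y‖ ^ 2 := by
      refine (i1.const_mul (‖curlCLM‖ ^ 2)).mono'
        (((continuous_curl (hv3.of_le (by norm_cast))).norm.pow 2).aestronglyMeasurable)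
        (Eventually.of_forall fun y => ?_)
      rw [Real.norm_of_nonneg (sq_nonneg _), ← mul_pow]
      exact pow_le_pow_left₀ (norm_nonneg _) (norm_curl_le (v r) y) 2
    rw [toReal_eLpNorm_two_eq_sqrt (continuous_curl (hv3.of_le (by norm_cast))) hI, Real.sqrt_eq_rpow]
  -- the shifted weight
  set k' : ℝ → ℝ := fun r => k (r + t₁) with hk'
  have hk'c : ContinuousOn k' (Icc 0 L) := hkc.comp (continuous_add_const t₁).continuousOn hmem
  have hk'0 : ∀ r ∈ Icc 0 L, 0 ≤ k' r := fun r hr => hk0 (r + t₁) (hmem r hr)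
  -- the rate on the slab
  have hrate' : ∀ r ∈ Icc 0 L, 0 < r → ∀ x₀ : EuclideanSpace ℝ (Fin 3),
      (∀ y, ‖curl (v r) y‖ ≤ ‖curl (v r) x₀‖) → ε < (Trel - r) * ‖curl (v r) x₀‖ →
      ⟪vorticityDirection (curl (v r)) x₀, fderiv ℝ (v r) x₀ (vorticityDirection (curl (v r)) x₀)⟫ -
          ν * frobeniusNormSq (fderiv ℝ (vorticityDirection (curl (v r))) x₀) ≤
        a / (Trel - r) + k' r * (eLpNorm (curl (v r)) 2 volume).toReal := by
    intro r hr hrpos x₀ hmax hcrit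
    have hTT : T - (r + t₁) = Trel - r := by rw [hTrel]; ring
    have h := hrate (r + t₁) ⟨by linarith, (hmem r hr).2⟩ x₀ hmax (by rw [hTT]; exact hcrit)
    rw [hTT] at h
    rw [hψ r hr]
    exact h
  have hM' : ∀ y, ‖curl (v 0) y‖ ≤ ε / Trel + c * Trel ^ (-a) := fun y => by
    simp only [hv, zero_add]; exact hM y
  have hbar := norm_curl_le_barrier_exp_of_argmax_rate_le_weighted hν hL hLT ha hε hc hk'c hk'0 hS hB
    hrate' hM' (s - t₁) ⟨by linarith [hs.1], by rw [hLdef]; linarith [hs.2]⟩ x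
  have hvs : v (s - t₁) = u s := by simp [hv]
  have hTs : Trel - (s - t₁) = T - s := by rw [hTrel]; ring
  rw [hvs, hTs] at hbar
  -- move the exponent back to `[t₁, s]`
  have hint : ∫ r in (0 : ℝ)..(s - t₁), k' r * (eLpNorm (curl (v r)) 2 volume).toReal =
      ∫ r in t₁..s, k r * (∫ y, ‖curl (u r) y‖ ^ 2) ^ (1 / (2 : ℝ)) := by
    have h1 : ∫ r in (0 : ℝ)..(s - t₁), k' r * (eLpNorm (curl (v r)) 2 volume).toReal =
        ∫ r in (0 : ℝ)..(s - t₁), k' r * (∫ y, ‖curl (u (r + t₁)) y‖ ^ 2) ^ (1 / (2 : ℝ)) := by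
      refine intervalIntegral.integral_congr fun r hr => ?_
      have hr' : r ∈ Icc 0 L := by
        rw [uIcc_of_le (by linarith [hs.1])] at hr
        exact ⟨hr.1, by rw [hLdef]; linarith [hr.2, hs.2]⟩
      simp only [hψ r hr']
    rw [h1]
    have h2 := intervalIntegral.integral_comp_add_right
      (fun τ => k τ * (∫ y, ‖curl (u τ) y‖ ^ 2) ^ (1 / (2 : ℝ))) t₁ (a := 0) (b := s - t₁)
    simp only [zero_add, sub_add_cancel] at h2
    simpa [hk'] using h2
  rw [hint] at hbar
  exact hbar

/-- **Plate E♭ «NearEngine» PROVED BY NAME** (the constant-weight case of E♭w). [folklore] -/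
theorem nearEngine_holds : NearEngine := by
  intro ν T u p hν hsol hreg t₁ t₂ a ε c k ht₁ h₁₂ ht₂ ha hε hc hk hrate hM s hs x
  have h := nearEngineWeighted_holds ν T u p hν hsol hreg t₁ t₂ a ε c (fun _ => k) ht₁ h₁₂ ht₂ ha hε hc
    continuousOn_const (fun _ _ => hk) hrate hM s hs x
  have hint : ∫ r in t₁..s, (fun _ => k) r * (∫ y, ‖curl (u r) y‖ ^ 2) ^ (1 / (2 : ℝ)) =
      k * ∫ r in t₁..s, (∫ y, ‖curl (u r) y‖ ^ 2) ^ (1 / (2 : ℝ)) := by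
    simp only [intervalIntegral.integral_const_mul]
  rw [hint] at h
  exact h

end Summit.NavierStokesRegularity.NavierStokesRegularity.Theorems.ArgmaxDoors

end
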